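import Literature.Analysis.SpecialFunctions.ContinuousMultiplicativeCharacterDifferentiable   -- ★ B-p17: `exists_cexp_mul_eq_of_continuous_of_map_add`, `map_one_of_map_mul_of_ne_zero`, `differentiableAt_of_map_mul_complex`
import HarnessLib

/-!
# Continuous multiplicative characters of `ℝˣ` and `ℂˣ` are `C^∞`: the local exponential form `χ z = χ z₀ · exp(c₁ re log(z∕z₀) + c₂ im log(z∕z₀))` EXPORTED
# (Tate's thesis §2.3 «`c(α) = c̃(α)‖α‖^s`», «`μ_w(z) = (z∕|z|)^t |z|^s`»)

Topic `Analysis/SpecialFunctions`; namespace `Literature.Analysis.SpecialFunctions`.  THEOREMS ONLY (no `def`, no instance, no notation, no axiom, no `sorry`); everything from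
Mathlib + the sibling ★ `ContinuousMultiplicativeCharacterDifferentiable` (B-p17), whose PROOF of `differentiableAt_of_map_mul_complex` contains the local exponential form but exports only
differentiability.  Cell `pub/hodgecm-mathlib`, line LH3 (closer stub `stub_N9`, crux H413 = `stmt-HodgeConjecture-24833`), brick **(μ∞-C^∞)** of LH3-p04 (g2)'s census (D-i-def)
(LH3-plan (g2) DEALER WORDS #3, 2026-09-02): the all-orders smoothness of the place factors `F_w(z) = μ_∞(ι_w z)` of a Hecke character that the (I₁) clause «bounded derivatives of
ALL orders of `Δ″_∞ = τ · D_{G∕H,∞} · Π κ_w` on the `G`-regular parts of the tori» of organ (M1) needs (consumer: the (I₁-Δ) file; docking through ★ `archHeckeValue_single_mul`,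
★ `continuousAt_archHeckeValue_single`, ★ `archHeckeValue_single_ne_zero`).

THE MATHEMATICS [TateThesis1967 §2.3; Bump1997 §3.1].  A multiplicative `χ : ℂ ∖ {0} → ℂ ∖ {0}` continuous at every non-zero point has two one-parameter subgroups `t ↦ χ(eᵗ) = e^{c₁t}`,
`s ↦ χ(e^{is}) = e^{c₂s}` (★ `exists_cexp_mul_eq_of_continuous_of_map_add`), hence for ALL `z, z₀ ≠ 0`: `χ z = χ z₀ · exp(c₁ · re log(z∕z₀)) · exp(c₂ · im log(z∕z₀))` with the SAME
`c₁, c₂` — an identity, not only a germ; near `z₀` the right side is `C^∞` (`log` is analytic on the slit plane and `z∕z₀` is near `1`).  Same on `ℝ ∖ {0}` with one exponent.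

WHAT IS PROVED.
* `exists_forall_eq_mul_cexp_of_map_mul_complex` — the GLOBAL two-exponent form (`∃ c₁ c₂, ∀ z₀ z ≠ 0, χ z = χ z₀ · exp(c₁ re log(z∕z₀)) · exp(c₂ im log(z∕z₀))`).
* **`contDiffAt_of_map_mul_complex`** — `ContDiffAt ℝ n χ z₀` at every `z₀ ≠ 0`, every `n : WithTop ℕ∞` (so `C^∞` and even `C^ω`-grade `n = ⊤`… we state `n` arbitrary).
* `contDiffOn_of_map_mul_complex` — `ContDiffOn ℝ n χ {z | z ≠ 0}`.
* `exists_forall_eq_mul_cexp_of_map_mul_real`, **`contDiffAt_of_map_mul_real`** — the real line twins.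
HONEST LABEL: HC_CM is proved only modulo the 7 printed citations (2 remaining: hLiu418 = stmt-HodgeConjecture-24832, h413 = stmt-HodgeConjecture-24833) until rung 0 closes; this file
is real analysis and pays nothing by itself.

## References
* [TateThesis1967] J. Tate, *Fourier analysis in number fields and Hecke's zeta-functions* (1950), in Cassels–Fröhlich, *Algebraic Number Theory* (1967), §2.3 (quasi-characters
  `c(α) = c̃(α)‖α‖^s`).
* [Bump1997] D. Bump, *Automorphic Forms and Representations* (1997), §3.1 (continuous characters of `ℝ` are exponentials; Exercise 3.1.1(f)).
-/

set_option autoImplicit false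

noncomputable section

open Complex Filter Topology Set

namespace Literature.Analysis.SpecialFunctions

/-! ## §1 `ℂ ∖ {0}` -/

/-- **GLOBAL TWO-EXPONENT FORM of a continuous multiplicative character of `ℂˣ`**: there are `c₁, c₂ ∈ ℂ` (the exponents of `t ↦ χ(eᵗ)` and `s ↦ χ(e^{is})`) with
`χ z = χ z₀ · exp(c₁ · re log(z∕z₀)) · exp(c₂ · im log(z∕z₀))` for ALL `z₀, z ≠ 0` — print's «`μ_w(z) = (z∕|z|)^t |z|^s`» in exponential dress, periodicity not yet imposed.
[cite: TateThesis1967, §2.3] [cite: Bump1997, §3.1] -/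
theorem exists_forall_eq_mul_cexp_of_map_mul_complex {χ : ℂ → ℂ} (hmul : ∀ a b : ℂ, a ≠ 0 → b ≠ 0 → χ (a * b) = χ a * χ b)
    (hcont : ∀ a : ℂ, a ≠ 0 → ContinuousAt χ a) (hne : ∀ a : ℂ, a ≠ 0 → χ a ≠ 0) :
    ∃ c₁ c₂ : ℂ, ∀ z₀ z : ℂ, z₀ ≠ 0 → z ≠ 0 →
      χ z = χ z₀ * (cexp (c₁ * ((Complex.log (z / z₀)).re : ℂ)) * cexp (c₂ * ((Complex.log (z / z₀)).im : ℂ))) := by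
  have h1 : χ 1 = 1 := map_one_of_map_mul_of_ne_zero hmul hne
  -- the two one-parameter subgroups
  have hφ₁c : Continuous fun t : ℝ => χ (cexp (t : ℂ)) :=
    continuous_iff_continuousAt.mpr fun t =>
      ContinuousAt.comp (f := fun t : ℝ => cexp (t : ℂ)) (hcont _ (Complex.exp_ne_zero _))
        (Complex.continuous_exp.comp Complex.continuous_ofReal).continuousAt
  have hφ₂c : Continuous fun s : ℝ => χ (cexp ((s : ℂ) * I)) :=
    continuous_iff_continuousAt.mpr fun s =>
      ContinuousAt.comp (f := fun s : ℝ => cexp ((s : ℂ) * I)) (hcont _ (Complex.exp_ne_zero _))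
        (Complex.continuous_exp.comp (Complex.continuous_ofReal.mul continuous_const)).continuousAt
  obtain ⟨c₁, hc₁⟩ := exists_cexp_mul_eq_of_continuous_of_map_add (fun t => χ (cexp (t : ℂ))) hφ₁c
    (fun s t => by simp only [Complex.ofReal_add, Complex.exp_add, hmul _ _ (Complex.exp_ne_zero _) (Complex.exp_ne_zero _)])
    (by simp only [Complex.ofReal_zero, Complex.exp_zero, h1])
  obtain ⟨c₂, hc₂⟩ := exists_cexp_mul_eq_of_continuous_of_map_add (fun s => χ (cexp ((s : ℂ) * I))) hφ₂c
    (fun s t => by simp only [Complex.ofReal_add, add_mul, Complex.exp_add, hmul _ _ (Complex.exp_ne_zero _) (Complex.exp_ne_zero _)])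
    (by simp only [Complex.ofReal_zero, zero_mul, Complex.exp_zero, h1])
  refine ⟨c₁, c₂, fun z₀ z hz hzne => ?_⟩
  have hq : z / z₀ ≠ 0 := div_ne_zero hzne hz
  set ℓ := Complex.log (z / z₀) with hℓ
  have hsplit : cexp ℓ = cexp (ℓ.re : ℂ) * cexp ((ℓ.im : ℂ) * I) := by
    rw [← Complex.exp_add, Complex.re_add_im]
  calc χ z = χ (z₀ * (z / z₀)) := by rw [mul_div_cancel₀ z hz]
    _ = χ z₀ * χ (cexp ℓ) := by rw [hmul _ _ hz hq, hℓ, Complex.exp_log hq]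
    _ = χ z₀ * (χ (cexp (ℓ.re : ℂ)) * χ (cexp ((ℓ.im : ℂ) * I))) := by
        rw [hsplit, hmul _ _ (Complex.exp_ne_zero _) (Complex.exp_ne_zero _)]
    _ = χ z₀ * (cexp (c₁ * (ℓ.re : ℂ)) * cexp (c₂ * (ℓ.im : ℂ))) := by rw [hc₁, hc₂]

/-- **A continuous multiplicative character of `ℂˣ` is `C^∞` (indeed `ContDiffAt ℝ n` for every `n`) at every `z₀ ≠ 0`**: near `z₀` it is
`χ z₀ · exp(c₁ re log(z∕z₀)) · exp(c₂ im log(z∕z₀))` and `z ↦ log(z∕z₀)` is analytic near `z₀` (`z∕z₀` near `1 ∈` slit plane).  The all-orders upgrade of ★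
`differentiableAt_of_map_mul_complex`. [cite: TateThesis1967, §2.3] [cite: Bump1997, §3.1] -/
theorem contDiffAt_of_map_mul_complex {χ : ℂ → ℂ} (hmul : ∀ a b : ℂ, a ≠ 0 → b ≠ 0 → χ (a * b) = χ a * χ b)
    (hcont : ∀ a : ℂ, a ≠ 0 → ContinuousAt χ a) (hne : ∀ a : ℂ, a ≠ 0 → χ a ≠ 0) {n : WithTop ℕ∞} {z₀ : ℂ} (hz : z₀ ≠ 0) :
    ContDiffAt ℝ n χ z₀ := by
  obtain ⟨c₁, c₂, hform⟩ := exists_forall_eq_mul_cexp_of_map_mul_complex hmul hcont hne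
  have hev : χ =ᶠ[𝓝 z₀] fun z => χ z₀ * (cexp (c₁ * ((Complex.log (z / z₀)).re : ℂ)) * cexp (c₂ * ((Complex.log (z / z₀)).im : ℂ))) := by
    filter_upwards [isOpen_ne.mem_nhds hz] with z hzne
    exact hform z₀ z hz hzne
  refine ContDiffAt.congr_of_eventuallyEq ?_ hev
  have hlog : ContDiffAt ℝ n (fun z : ℂ => Complex.log (z / z₀)) z₀ := by
    have hdiv : ContDiffAt ℂ n (fun z : ℂ => z / z₀) z₀ := contDiffAt_id.div_const z₀
    exact (ContDiffAt.comp z₀ (Complex.contDiffAt_log (by rw [div_self hz]; exact Complex.one_mem_slitPlane)) hdiv).restrict_scalars ℝ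
  have hre : ContDiffAt ℝ n (fun z : ℂ => ((Complex.log (z / z₀)).re : ℂ)) z₀ :=
    Complex.ofRealCLM.contDiff.contDiffAt.comp z₀ (Complex.reCLM.contDiff.contDiffAt.comp z₀ hlog)
  have him : ContDiffAt ℝ n (fun z : ℂ => ((Complex.log (z / z₀)).im : ℂ)) z₀ :=
    Complex.ofRealCLM.contDiff.contDiffAt.comp z₀ (Complex.imCLM.contDiff.contDiffAt.comp z₀ hlog)
  exact contDiffAt_const.mul (((contDiffAt_const.mul hre).cexp).mul ((contDiffAt_const.mul him).cexp))

/-- **… hence `C^n` on `ℂ ∖ {0}`** (open set: `ContDiffOn` from `ContDiffAt` pointwise). [cite: TateThesis1967, §2.3] -/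
theorem contDiffOn_of_map_mul_complex {χ : ℂ → ℂ} (hmul : ∀ a b : ℂ, a ≠ 0 → b ≠ 0 → χ (a * b) = χ a * χ b)
    (hcont : ∀ a : ℂ, a ≠ 0 → ContinuousAt χ a) (hne : ∀ a : ℂ, a ≠ 0 → χ a ≠ 0) {n : WithTop ℕ∞} :
    ContDiffOn ℝ n χ {z : ℂ | z ≠ 0} :=
  fun _ hz => (contDiffAt_of_map_mul_complex hmul hcont hne hz).contDiffWithinAt

/-! ## §2 `ℝ ∖ {0}` -/

/-- **ONE-EXPONENT FORM on `ℝˣ`**: `χ a = χ a₀ · exp(c · log(a∕a₀))` whenever `a∕a₀ > 0` (same sign component), with ONE `c` (the exponent of `t ↦ χ(eᵗ)`).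
[cite: TateThesis1967, §2.3] [cite: Bump1997, §3.1] -/
theorem exists_forall_eq_mul_cexp_of_map_mul_real {χ : ℝ → ℂ} (hmul : ∀ a b : ℝ, a ≠ 0 → b ≠ 0 → χ (a * b) = χ a * χ b)
    (hcont : ∀ a : ℝ, a ≠ 0 → ContinuousAt χ a) (hne : ∀ a : ℝ, a ≠ 0 → χ a ≠ 0) :
    ∃ c : ℂ, ∀ a₀ a : ℝ, a₀ ≠ 0 → 0 < a / a₀ → χ a = χ a₀ * cexp (c * (Real.log (a / a₀) : ℂ)) := by
  have h1 : χ 1 = 1 := map_one_of_map_mul_of_ne_zero hmul hne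
  have hφc : Continuous fun t : ℝ => χ (Real.exp t) :=
    continuous_iff_continuousAt.mpr fun t => (hcont _ (Real.exp_pos t).ne').comp (Real.continuous_exp.continuousAt)
  obtain ⟨c, hc⟩ := exists_cexp_mul_eq_of_continuous_of_map_add (fun t => χ (Real.exp t)) hφc
    (fun s t => by simp only [Real.exp_add, hmul _ _ (Real.exp_pos s).ne' (Real.exp_pos t).ne']) (by simp only [Real.exp_zero, h1])
  refine ⟨c, fun a₀ a ha hpos => ?_⟩
  have hq : a / a₀ ≠ 0 := hpos.ne'
  calc χ a = χ (a₀ * (a / a₀)) := by rw [mul_div_cancel₀ a ha]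
    _ = χ a₀ * χ (Real.exp (Real.log (a / a₀))) := by rw [hmul _ _ ha hq, Real.exp_log hpos]
    _ = χ a₀ * cexp (c * (Real.log (a / a₀) : ℂ)) := by rw [hc]

/-- **A continuous multiplicative character of `ℝˣ` is `C^∞` at every `a₀ ≠ 0`** (all-orders upgrade of ★ `differentiableAt_of_map_mul_real`).
[cite: TateThesis1967, §2.3] [cite: Bump1997, §3.1] -/
theorem contDiffAt_of_map_mul_real {χ : ℝ → ℂ} (hmul : ∀ a b : ℝ, a ≠ 0 → b ≠ 0 → χ (a * b) = χ a * χ b)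
    (hcont : ∀ a : ℝ, a ≠ 0 → ContinuousAt χ a) (hne : ∀ a : ℝ, a ≠ 0 → χ a ≠ 0) {n : WithTop ℕ∞} {a₀ : ℝ} (ha : a₀ ≠ 0) :
    ContDiffAt ℝ n χ a₀ := by
  obtain ⟨c, hform⟩ := exists_forall_eq_mul_cexp_of_map_mul_real hmul hcont hne
  have hev : χ =ᶠ[𝓝 a₀] fun a => χ a₀ * cexp (c * (Real.log (a / a₀) : ℂ)) := by
    have hopen : IsOpen {a : ℝ | 0 < a / a₀} := isOpen_lt continuous_const (continuous_id.div_const a₀)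
    filter_upwards [hopen.mem_nhds (show 0 < a₀ / a₀ by rw [div_self ha]; exact one_pos)] with a hpos
    exact hform a₀ a ha hpos
  refine ContDiffAt.congr_of_eventuallyEq ?_ hev
  have hlog : ContDiffAt ℝ n (fun a : ℝ => Real.log (a / a₀)) a₀ := by
    have hdiv : ContDiffAt ℝ n (fun a : ℝ => a / a₀) a₀ := contDiffAt_id.div_const a₀
    exact (Real.contDiffAt_log.2 (by rw [div_self ha]; exact one_ne_zero)).comp a₀ hdiv
  have hofReal : ContDiffAt ℝ n (fun a : ℝ => (Real.log (a / a₀) : ℂ)) a₀ := Complex.ofRealCLM.contDiff.contDiffAt.comp a₀ hlog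
  exact contDiffAt_const.mul (contDiffAt_const.mul hofReal).cexp

end Literature.Analysis.SpecialFunctions

end
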